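import Summits.ResolutionOfSingularities.ResolutionOfSingularities.Theorems.FrobeniusLadderFInjectiveMacaulayficationCMFILocalizesHolds
import Literature.RingTheory.TightClosure.HashimotoGradedCMFI
import HarnessLib

/-!
# (A1) `cmfiCl_of_vertex` modulo Hashimoto 2010 Cor. 5.2 BY NAME
# (crux `FInjectiveMacaulayfication` stmt-ResolutionOfSingularities-15315, chain w45a, THEOREM-D programme (A1); the named fact
# `Literature.RingTheory.TightClosure.Hashimoto2010_cmfi_of_homogeneousCore` (res-D-pv-019 AS stub-7, p567781) landed; seat res-L1-w45a-stub-2)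

[OURS · L1 W4.5a] Support file (`--supports stmt-ResolutionOfSingularities-15315 --as helper`); NOT a statement of any manuscript; def-free; CONDITIONAL on ONE
printed theorem BY NAME (Hashimoto 2010 Cor. 5.2); AI-written (AI review is weaker than expert review).

`cmfiCl_of_vertex (hH : Hashimoto2010_cmfi_of_homogeneousCore.{0}) p 𝒪 F (hV : ∃ N, 0 < N ∧ IsVeronese F N) (h𝔑) : ∀ 𝔓, CMCl ∧ FCl at 𝔓` — ThmDSig §3d
in its exact consumer shape: the spelled-out hypothesis of `CMFILocalizesHolds.cmfiCl_of_vertex` IS the token text of the named fact at universe `0`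
(by `δ`); Cor. 4.7 was discharged in the tree (`CMFILocalizesHolds.hashimoto2010_cmfiLocalizes_holds`). [cite: Hashimoto2010, Cor. 5.2]
-/

-- single-problem summit: the doubled namespace component is forced
set_option linter.dupNamespace false

noncomputable section

namespace Summit.ResolutionOfSingularities.ResolutionOfSingularities.Theorems.FInjectiveMacaulayfication.CmfiClOfVertexNamed

open IsLocalRing
open Summit.ResolutionOfSingularities.ResolutionOfSingularities.Theorems.FInjectiveMacaulayfication
open GDD

/-- **§3d `cmfiCl_of_vertex` — VERTEX ⇒ EVERY PRIME of `G(F)[1/1̄·T⁰]` — modulo Hashimoto 2010 Cor. 5.2 BY NAME.** [OURS · conditional-result]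
[cite: Hashimoto2010, Cor. 5.2] -/
theorem cmfiCl_of_vertex (hH : Literature.RingTheory.TightClosure.Hashimoto2010_cmfi_of_homogeneousCore.{0})
    (p : ℕ) [Fact p.Prime] (𝒪 : Type) [CommRing 𝒪] [IsNoetherianRing 𝒪] [IsLocalRing 𝒪] [CharP 𝒪 p]
    (F : MultFiltration 𝒪) (hV : ∃ N, 0 < N ∧ IsVeronese F N)
    (h𝔑 : ∀ (𝔑 : Ideal (Localization.Away (homogBar F 0 1 (one_mem_I_zero 𝒪 F)))) [𝔑.IsMaximal],
      ((∀ x ∈ maximalIdeal 𝒪, algebraMap 𝒪 (Localization.Away (homogBar F 0 1 (one_mem_I_zero 𝒪 F))) x ∈ 𝔑) ∧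
        ∀ (n : ℕ), 0 < n → ∀ (a : 𝒪) (ha : a ∈ F.I n),
          (OreLocalization.numeratorRingHom (homogBar F n a ha) : Localization.Away (homogBar F 0 1 (one_mem_I_zero 𝒪 F))) ∈ 𝔑) →
      SliceableCentre.CMCl (Localization.AtPrime 𝔑) ∧ SliceableCentre.FCl p (Localization.AtPrime 𝔑)) :
    ∀ (𝔓 : Ideal (Localization.Away (homogBar F 0 1 (one_mem_I_zero 𝒪 F)))) [𝔓.IsPrime],
      SliceableCentre.CMCl (Localization.AtPrime 𝔓) ∧ SliceableCentre.FCl p (Localization.AtPrime 𝔓) :=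
  CMFILocalizesHolds.cmfiCl_of_vertex (fun p _ A _ _ _ 𝒜 _ P _ _ h => hH p A 𝒜 P h) p 𝒪 F hV h𝔑

end Summit.ResolutionOfSingularities.ResolutionOfSingularities.Theorems.FInjectiveMacaulayfication.CmfiClOfVertexNamed

end
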